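import Literature.Probability.Process.BrownianVec
import Mathlib.Analysis.InnerProductSpace.PiL2
import Mathlib.Analysis.Normed.Lp.MeasurableSpace
import Mathlib.Analysis.SpecialFunctions.Log.Basic
import Mathlib.MeasureTheory.Integral.Bochner.Basic
import HarnessLib

/-!
# The Boué–Dupuis variational value and the Boué–Dupuis formula

Topic `Probability/Process`. For a process `X : ℝ≥0 → Ω → E` on a filtered probability space
`(Ω, ℱ, P)` with values in a real normed space `E` (intended: a finite-dimensional real inner
product space, e.g. `EuclideanSpace ℝ (Fin d)`), a horizon `T : ℝ≥0` and a functional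
`F : ([0, T] → E) → ℝ` of paths on `[0, T]`, the **Boué–Dupuis variational value** is

  `boueDupuisValue P ℱ X T F = inf_v E_P[ F((X + ∫₀^· v_s ds)|[0,T]) + ½ ∫₀ᵀ ‖v_s‖² ds ]`,

the infimum running over the **admissible drifts** `v : ℝ≥0 → Ω → E`: progressively measurable
with respect to `ℱ` and of finite expected energy `E ∫₀ᵀ ‖v_s‖² ds < ∞`
(`Literature.Probability.Process.IsAdmissibleDrift`; the cost of one drift is
`Literature.Probability.Process.boueDupuisCost`).

The **Boué–Dupuis formula** (Boué–Dupuis, *Ann. Probab.* 26 (1998), main theorem = eq. (1.1) of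
Budhiraja's survey arXiv:2403.01562; Lehec (2013) Thm 9; general filtrations:
Budhiraja–Dupuis (2000) as restated in Budhiraja (2024), Thm 2.1–2.2) is vendored as the NAMED
FACT `Literature.Probability.Process.boueDupuis_formula`: if `W` is a standard `d`-dimensional
`ℱ`-Brownian motion (`Literature.Probability.Process.IsFBrownianVec`: the tree's `IsBrownianVec`
plus `ℱ`-adaptedness and independence of the future increments from `ℱ s`) and `F` is bounded
and measurable, then

  `-log E_P[exp(-F(W|[0,T]))] = boueDupuisValue P ℱ W T F`.

Proved here: the zero drift is admissible and its cost is `E F(X|[0,T])`, hence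
`boueDupuisValue ≤ E F(X|[0,T])` and the elementary `inf`-API (`le_boueDupuisValue`,
`boueDupuisValue_le_boueDupuisCost`, lower bound `min m 0` for `F ≥ m`); a Brownian motion is
an `ℱ`-Brownian motion for its own raw natural filtration
(`IsBrownianVec.isFBrownianVec_natFiltration`), which specialises the fact to the original
Boué–Dupuis setting (`boueDupuis_formula.natFiltration`).

## Design choices

* Paths on `[0, T]` are elements of the product space `Set.Icc (0 : ℝ≥0) T → E` with the product
  σ-algebra, and `F` is any (bounded, product-measurable) real function on it. The sources take
  `F` bounded Borel on `C([0,T]; ℝᵈ)` with the uniform topology; since the Borel σ-algebra of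
  `C([0,T]; ℝᵈ)` is the trace of the product σ-algebra (Billingsley (1999), Example 1.3; in the
  tree `borel_continuousMap_eq_iSup_comap_eval`), the bounded Borel functionals on `C([0,T]; ℝᵈ)`
  are exactly the restrictions of bounded product-measurable functionals, and both sides of the
  formula only evaluate `F` at paths `W + ∫₀^· v` which are continuous for `P`-a.e. `ω`. So the
  fact is the printed theorem, with no topology on path space needed.
* Time integrals `∫₀ᵗ … ds` are integrals over `Set.Icc (0 : ℝ) t` for Lebesgue measure composed
  with `Real.toNNReal` (the tree's convention, `ItoCalculus`, `ProgressiveDensity`); the energy is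
  an extended integral `∫⁻` (no Bochner junk value), the drift integral `∫₀ᵗ v_s ds` a Bochner
  integral in `E`.
* The energy uses `‖·‖` of `E`: instantiate `E` with a genuine inner product space
  (`EuclideanSpace ℝ (Fin d)`, as the fact does), NOT with `Fin d → ℝ` and its sup norm.
* Admissible drifts are `ℱ`-progressively measurable (Mathlib `MeasureTheory.IsStronglyProgressive`)
  with finite *expected* energy, exactly the class `𝒜` of Boué–Dupuis (1998) except that `ℱ` is an
  arbitrary filtration for which `W` is a Brownian motion and is *not* augmented. Neither change
  affects the infimum: the cost of `v` depends only on its `ds ⊗ dP`-equivalence class, and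
  near-optimal drifts may be taken simple with bounded `σ(W_r : r ≤ tⱼ)ᵃᵘᵍ`-measurable values
  (Budhiraja (2024), Thm 2.2), which agree a.s. with raw-measurable ones; for general `{ℱ_t}`
  see Budhiraja (2024), Thm 2.1 (from Budhiraja–Dupuis (2000)) and Lehec (2013), Prop. 1 / Thm 9.
* The value is a real number, `sInf` of the set of costs; this set is nonempty (zero drift) and,
  for `F` bounded below on a probability space, bounded below (`min_le_boueDupuisCost`), so no
  junk value occurs in the regime of the fact. For unbounded `F` the Bochner expectations inside
  `boueDupuisCost` carry Mathlib's junk value `0` on non-integrable integrands; extensions of the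
  formula to `F` bounded from one side / tame / merely integrable (Hariya–Watanabe (2022) Thm 1.1
  and Rmk 1.1; Üstünel (2014); Barashkov–Gubinelli (2020) Thm 2) are deliberately NOT vendored.

## References

* M. Boué, P. Dupuis, *A variational representation for certain functionals of Brownian
  motion*, Ann. Probab. 26 (1998), 1641–1659. [BoueDupuis1998]
* A. Budhiraja, *On some extensions of the Boué–Dupuis variational formula*, arXiv:2403.01562
  (2024), eq. (1.1), Thm 2.1, Thm 2.2. [Budhiraja2024]
* J. Lehec, *Representation formula for the entropy and functional inequalities*, Ann. IHP
  Probab. Stat. 49 (2013), Prop. 1, Thm 9. [Lehec2013]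
* P. Sundar, M. Tao, Commun. Stoch. Anal. 6 (2012), Thm 3.1 (restatement and a second proof).
  [SundarTao2012]
* Y. Hariya, S. Watanabe, Electron. Commun. Probab. 27 (2022), eq. (1.1), Thm 1.1.
  [HariyaWatanabe2022]
* N. Barashkov, M. Gubinelli, *A variational method for Φ⁴₃*, Duke Math. J. 169 (2020), Thm 2.
  [BarashkovGubinelli2020]
-/

noncomputable section

open MeasureTheory ProbabilityTheory Set
open scoped NNReal ENNReal

namespace Literature.Probability.Process

variable {Ω : Type*} {mΩ : MeasurableSpace Ω}

/-! ### Paths on `[0, T]` -/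

section PathOn

variable {E : Type*}

/-- The restriction of the path `t ↦ X_t(ω)` to the horizon `[0, T]`, as an element of the product
space `Set.Icc 0 T → E`. [folklore] -/
def pathOn (T : ℝ≥0) (X : ℝ≥0 → Ω → E) (ω : Ω) : Icc (0 : ℝ≥0) T → E := fun t ↦ X t ω

/-- Unfolding `pathOn`. [folklore] -/
@[simp] theorem pathOn_apply (T : ℝ≥0) (X : ℝ≥0 → Ω → E) (ω : Ω) (t : Icc (0 : ℝ≥0) T) :
    pathOn T X ω t = X t ω := rfl

/-- `pathOn` is measurable for the product σ-algebra as soon as every marginal is. [folklore] -/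
theorem measurable_pathOn [MeasurableSpace E] {T : ℝ≥0} {X : ℝ≥0 → Ω → E}
    (hX : ∀ t, Measurable (X t)) : Measurable (pathOn T X) :=
  measurable_pi_lambda _ fun t ↦ hX t

end PathOn

/-! ### Drifts: energy and admissibility (only the norm of `E` is used) -/

section Energy

variable {E : Type*} [NormedAddCommGroup E]

/-- The **energy** `∫₀ᵀ ‖v_s(ω)‖² ds ∈ [0, ∞]` of a drift on `[0, T]` (extended integral, so
that finiteness is a genuine condition). [folklore] -/
def driftEnergy (v : ℝ≥0 → Ω → E) (T : ℝ≥0) (ω : Ω) : ℝ≥0∞ :=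
  ∫⁻ s in Icc (0 : ℝ) T, ENNReal.ofReal (‖v s.toNNReal ω‖ ^ 2)

/-- **Admissible drifts** on `[0, T]` (the class `𝒜` of Boué–Dupuis): `v` is progressively
measurable with respect to the filtration `ℱ` and has finite expected energy
`E_P ∫₀ᵀ ‖v_s‖² ds < ∞` (restated with horizon `T` in Budhiraja (2024), eq. (1.1)).
[cite: BoueDupuis1998, Thm 3.1 (class 𝒜)] -/
structure IsAdmissibleDrift (ℱ : Filtration ℝ≥0 mΩ) (P : Measure Ω) (T : ℝ≥0)
    (v : ℝ≥0 → Ω → E) : Prop where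
  /-- The drift is `ℱ`-progressively measurable. -/
  isStronglyProgressive : IsStronglyProgressive ℱ v
  /-- The drift has finite expected energy on `[0, T]`. -/
  lintegral_driftEnergy_lt_top : ∫⁻ ω, driftEnergy v T ω ∂P < ∞

/-- The zero drift has zero energy. [folklore] -/
@[simp] theorem driftEnergy_zero (T : ℝ≥0) (ω : Ω) :
    driftEnergy (0 : ℝ≥0 → Ω → E) T ω = 0 := by
  simp [driftEnergy]

/-- The zero drift is admissible. [folklore] -/
theorem isAdmissibleDrift_zero (ℱ : Filtration ℝ≥0 mΩ) (P : Measure Ω) (T : ℝ≥0) :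
    IsAdmissibleDrift ℱ P T (0 : ℝ≥0 → Ω → E) where
  isStronglyProgressive := isStronglyProgressive_const ℱ (0 : E)
  lintegral_driftEnergy_lt_top := by simp

/-- A deterministic constant drift is admissible on every finite horizon under a finite measure
(its energy is `T ‖e‖²`). [folklore] -/
theorem isAdmissibleDrift_const (ℱ : Filtration ℝ≥0 mΩ) (P : Measure Ω) [IsFiniteMeasure P]
    (T : ℝ≥0) (e : E) : IsAdmissibleDrift ℱ P T (fun _ _ ↦ e) where
  isStronglyProgressive := isStronglyProgressive_const ℱ e
  lintegral_driftEnergy_lt_top := by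
    have h : ∀ ω : Ω, driftEnergy (fun (_ : ℝ≥0) (_ : Ω) ↦ e) T ω
        = ENNReal.ofReal (‖e‖ ^ 2) * volume (Icc (0 : ℝ) T) := fun ω ↦ by
      simp [driftEnergy]
    simp_rw [h, Real.volume_Icc, lintegral_const]
    exact ENNReal.mul_lt_top (ENNReal.mul_lt_top ENNReal.ofReal_lt_top ENNReal.ofReal_lt_top)
      (measure_lt_top P _)

end Energy

/-! ### Drifted paths, the cost of a drift and the Boué–Dupuis value -/

section Value

variable {E : Type*} [NormedAddCommGroup E] [NormedSpace ℝ E]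

/-- The time integral `∫₀ᵗ v_s(ω) ds` of a drift (Bochner integral over `[0, t]` for Lebesgue
measure, the drift read in real time through `Real.toNNReal`). [folklore] -/
def driftIntegral (v : ℝ≥0 → Ω → E) (t : ℝ≥0) (ω : Ω) : E :=
  ∫ s in Icc (0 : ℝ) t, v s.toNNReal ω

/-- The **drifted path** `X^v_t(ω) = X_t(ω) + ∫₀ᵗ v_s(ω) ds` (for `X = W` a Brownian motion:
the Brownian motion shifted by the Cameron–Martin path `∫₀^· v`). [folklore] -/
def driftedPath (X v : ℝ≥0 → Ω → E) (t : ℝ≥0) (ω : Ω) : E :=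
  X t ω + driftIntegral v t ω

/-- The time integral of the zero drift vanishes. [folklore] -/
@[simp] theorem driftIntegral_zero (t : ℝ≥0) (ω : Ω) :
    driftIntegral (0 : ℝ≥0 → Ω → E) t ω = 0 := by
  simp [driftIntegral]

/-- The path drifted by the zero drift is the path. [folklore] -/
@[simp] theorem driftedPath_zero (X : ℝ≥0 → Ω → E) : driftedPath X 0 = X := by
  funext t ω
  simp [driftedPath]

/-- The **Boué–Dupuis cost** of a drift `v` for the functional `F` of paths on `[0, T]`:
`J(v) = E_P[ F(X^v|[0,T]) + ½ ∫₀ᵀ ‖v_s‖² ds ]` with `X^v = X + ∫₀^· v` (`driftedPath`).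
(Bochner expectation: meaningful when the integrand is integrable, e.g. `F` bounded measurable
and `v` admissible; Budhiraja (2024), eq. (1.1).) [cite: BoueDupuis1998, Thm 3.1] -/
def boueDupuisCost (P : Measure Ω) (X : ℝ≥0 → Ω → E) (T : ℝ≥0) (F : (Icc (0 : ℝ≥0) T → E) → ℝ)
    (v : ℝ≥0 → Ω → E) : ℝ :=
  ∫ ω, (F (pathOn T (driftedPath X v) ω) + (driftEnergy v T ω).toReal / 2) ∂P

/-- The **Boué–Dupuis variational value** of a functional `F` of paths on `[0, T]` along the
process `X` on the filtered space `(Ω, ℱ, P)`: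
`inf { E_P[ F(X^v|[0,T]) + ½ ∫₀ᵀ ‖v_s‖² ds ] : v ℱ-progressive, E_P ∫₀ᵀ ‖v_s‖² ds < ∞ }`,
a real number (`sInf`; the set is nonempty — zero drift — and bounded below when `F` is bounded
below and `P` is a probability measure, `min_le_boueDupuisCost`); Budhiraja (2024), eq. (1.1) and
Thm 2.1 for the horizon `T` and a general filtration. [cite: BoueDupuis1998, Thm 3.1] -/
def boueDupuisValue (P : Measure Ω) (ℱ : Filtration ℝ≥0 mΩ) (X : ℝ≥0 → Ω → E) (T : ℝ≥0)
    (F : (Icc (0 : ℝ≥0) T → E) → ℝ) : ℝ :=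
  sInf (boueDupuisCost P X T F '' {v | IsAdmissibleDrift ℱ P T v})

variable {P : Measure Ω} {ℱ : Filtration ℝ≥0 mΩ} {X : ℝ≥0 → Ω → E} {T : ℝ≥0}
  {F : (Icc (0 : ℝ≥0) T → E) → ℝ}

/-- The cost of the zero drift is `E_P F(X|[0,T])`. [folklore] -/
@[simp] theorem boueDupuisCost_zero (P : Measure Ω) (X : ℝ≥0 → Ω → E) (T : ℝ≥0)
    (F : (Icc (0 : ℝ≥0) T → E) → ℝ) :
    boueDupuisCost P X T F 0 = ∫ ω, F (pathOn T X ω) ∂P := by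
  simp [boueDupuisCost]

/-- On a probability space, if `F ≥ m` then every cost is `≥ min m 0` (the `0` covers the
Bochner junk value of a non-integrable integrand). [folklore] -/
theorem min_le_boueDupuisCost [IsProbabilityMeasure P] {m : ℝ} (hF : ∀ x, m ≤ F x)
    (v : ℝ≥0 → Ω → E) : min m 0 ≤ boueDupuisCost P X T F v := by
  unfold boueDupuisCost
  by_cases hf : Integrable
      (fun ω ↦ F (pathOn T (driftedPath X v) ω) + (driftEnergy v T ω).toReal / 2) P
  · calc min m 0 ≤ m := min_le_left _ _
      _ = ∫ _, m ∂P := by simp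
      _ ≤ ∫ ω, (F (pathOn T (driftedPath X v) ω) + (driftEnergy v T ω).toReal / 2) ∂P :=
          integral_mono (integrable_const m) hf fun ω ↦
            le_add_of_le_of_nonneg (hF _) (by positivity)
  · rw [integral_undef hf]
    exact min_le_right _ _

/-- The set of admissible costs is bounded below when `F` is (probability space). [folklore] -/
theorem bddBelow_image_boueDupuisCost [IsProbabilityMeasure P] (hF : ∃ m, ∀ x, m ≤ F x)
    (S : Set (ℝ≥0 → Ω → E)) : BddBelow (boueDupuisCost P X T F '' S) := by
  obtain ⟨m, hm⟩ := hF
  refine ⟨min m 0, ?_⟩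
  rintro _ ⟨v, -, rfl⟩
  exact min_le_boueDupuisCost hm v

/-- The set of admissible costs is nonempty (zero drift). [folklore] -/
theorem image_boueDupuisCost_nonempty (P : Measure Ω) (ℱ : Filtration ℝ≥0 mΩ)
    (X : ℝ≥0 → Ω → E) (T : ℝ≥0) (F : (Icc (0 : ℝ≥0) T → E) → ℝ) :
    (boueDupuisCost P X T F '' {v | IsAdmissibleDrift ℱ P T v}).Nonempty :=
  ⟨_, 0, isAdmissibleDrift_zero ℱ P T, rfl⟩

/-- **The value is a lower bound of the admissible costs**: `boueDupuisValue ≤ J(v)` for every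
admissible `v` (for `F` bounded below on a probability space). [folklore] -/
theorem boueDupuisValue_le_boueDupuisCost [IsProbabilityMeasure P] (hF : ∃ m, ∀ x, m ≤ F x)
    {v : ℝ≥0 → Ω → E} (hv : IsAdmissibleDrift ℱ P T v) :
    boueDupuisValue P ℱ X T F ≤ boueDupuisCost P X T F v :=
  csInf_le (bddBelow_image_boueDupuisCost hF _) ⟨v, hv, rfl⟩

/-- **The value is the greatest lower bound**: anything below every admissible cost is below
the value. [folklore] -/
theorem le_boueDupuisValue {c : ℝ}
    (h : ∀ v, IsAdmissibleDrift ℱ P T v → c ≤ boueDupuisCost P X T F v) :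
    c ≤ boueDupuisValue P ℱ X T F :=
  le_csInf (image_boueDupuisCost_nonempty P ℱ X T F) (by
    rintro _ ⟨v, hv, rfl⟩
    exact h v hv)

/-- Taking the zero drift: `boueDupuisValue ≤ E_P F(X|[0,T])` (in the setting of the
Boué–Dupuis formula this is Jensen's inequality `-log E e^{-F} ≤ E F`). [folklore] -/
theorem boueDupuisValue_le_integral [IsProbabilityMeasure P] (hF : ∃ m, ∀ x, m ≤ F x) :
    boueDupuisValue P ℱ X T F ≤ ∫ ω, F (pathOn T X ω) ∂P := by
  rw [← boueDupuisCost_zero P X T F]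
  exact boueDupuisValue_le_boueDupuisCost hF (isAdmissibleDrift_zero ℱ P T)

/-- A lower bound on `F` bounds the value from below: `min m 0 ≤ boueDupuisValue` if `F ≥ m`.
[folklore] -/
theorem min_le_boueDupuisValue [IsProbabilityMeasure P] {m : ℝ} (hF : ∀ x, m ≤ F x) :
    min m 0 ≤ boueDupuisValue P ℱ X T F :=
  le_boueDupuisValue fun v _ ↦ min_le_boueDupuisCost hF v

end Value

/-! ### Brownian motion with respect to a filtration -/

section FBrownian

variable {d : ℕ}

/-- **`d`-dimensional `ℱ`-Brownian motion**: a `d`-dimensional Brownian motion `W` (the tree's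
hypothesis structure `IsBrownianVec`: measurable marginals, continuous paths, `W_0 = 0`, weak
Markov property, Gaussian marginals `N(0, t I_d)`) which is adapted to the filtration `ℱ` and
whose future increments `(W_{s+u} - W_s)_{u ≥ 0}` are independent of `ℱ s` for every `s`.
[cite: Budhiraja2024, §1 ("{F_t}-Brownian motion"); Legall2016, Ch. 2] -/
structure IsFBrownianVec (ℱ : Filtration ℝ≥0 mΩ) (W : ℝ≥0 → Ω → (Fin d → ℝ)) (P : Measure Ω) :
    Prop extends IsBrownianVec W P where
  /-- `W` is adapted to `ℱ`. -/
  adapted : Adapted ℱ W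
  /-- The shifted process `u ↦ W_{s+u} - W_s` is independent of `ℱ s`. -/
  indep_vecShift : ∀ s, Indep (MeasurableSpace.comap (vecShift W s) inferInstance) (ℱ s) P

/-- **A Brownian motion is a Brownian motion for its raw natural filtration** (the weak Markov
property in σ-algebra form, `IsBrownianVec.indep_comap_vecShift_natFiltration`).
[cite: Legall2016, Ch. 2 (simple Markov property of Brownian motion)] -/
theorem IsBrownianVec.isFBrownianVec_natFiltration {W : ℝ≥0 → Ω → (Fin d → ℝ)} {P : Measure Ω}
    (hW : IsBrownianVec W P) : IsFBrownianVec hW.natFiltration W P where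
  toIsBrownianVec := hW
  adapted := fun t ↦ (hW.stronglyAdapted t).measurable
  indep_vecShift := hW.indep_comap_vecShift_natFiltration

/-! ### The Boué–Dupuis formula (named fact) -/

/-- **The Boué–Dupuis formula** (NAMED FACT, not proved here). Let `(Ω, ℱ, P)` be a filtered
probability space carrying a standard `d`-dimensional `ℱ`-Brownian motion `W` (with values in
`EuclideanSpace ℝ (Fin d)`; hypothesis `IsFBrownianVec` on its coordinate process), let
`T : ℝ≥0` and let `F` be a bounded measurable real functional of paths on `[0, T]`. Then

  `-log E_P[ exp(-F(W|[0,T])) ] = inf_{v ∈ 𝒜} E_P[ F((W + ∫₀^· v_s ds)|[0,T]) + ½ ∫₀ᵀ ‖v_s‖² ds ]`,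

the infimum (`boueDupuisValue P ℱ W T F`) running over the `ℱ`-progressively measurable drifts
with `E_P ∫₀ᵀ ‖v_s‖² ds < ∞`. Boué–Dupuis (1998), main theorem, for the augmented Brownian
filtration and horizon `1` (eq. (1.1) of Budhiraja (2024) for horizon `T`; also Sundar–Tao
(2012) Thm 3.1, Lehec (2013) Thm 9); for a general filtration `{ℱ_t}` making `W` an
`ℱ`-Brownian motion the infimum is the same (Budhiraja (2024), Thm 2.1–2.2, after
Budhiraja–Dupuis (2000); raw vs augmented filtration is immaterial since the cost depends only
on the `ds ⊗ dP`-class of `v`, see the module docstring).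
Theorem number: the representation theorem of §3 of Boué–Dupuis (1998) ('Thm 3.1'; the original is
not held — acq-02667 — and the statement was checked against Budhiraja (2024) eq. (1.1)/Thm 2.1,
Sundar–Tao (2012) Thm 3.1 and Hariya–Watanabe (2022) eq. (1.1)). [cite: BoueDupuis1998, Thm 3.1] -/
def boueDupuis_formula (P : Measure Ω) (ℱ : Filtration ℝ≥0 mΩ)
    (W : ℝ≥0 → Ω → EuclideanSpace ℝ (Fin d)) (T : ℝ≥0)
    (F : (Icc (0 : ℝ≥0) T → EuclideanSpace ℝ (Fin d)) → ℝ) : Prop :=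
  ∀ [IsProbabilityMeasure P], IsFBrownianVec ℱ (fun t ω ↦ WithLp.ofLp (W t ω)) P →
    Measurable F → (∃ C, ∀ x, |F x| ≤ C) →
      -Real.log (∫ ω, Real.exp (-F (pathOn T W ω)) ∂P) = boueDupuisValue P ℱ W T F

/-- **The Boué–Dupuis formula in its original setting**: for a `d`-dimensional Brownian motion
and drifts progressively measurable with respect to its own (raw) natural filtration — the
special case `ℱ = σ(W_r : r ≤ t)` of the named fact, via `isFBrownianVec_natFiltration`.
[cite: BoueDupuis1998, Thm 3.1] -/
theorem boueDupuis_formula.natFiltration {P : Measure Ω} [IsProbabilityMeasure P]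
    {W : ℝ≥0 → Ω → EuclideanSpace ℝ (Fin d)}
    (hW : IsBrownianVec (fun t ω ↦ WithLp.ofLp (W t ω)) P) {T : ℝ≥0}
    {F : (Icc (0 : ℝ≥0) T → EuclideanSpace ℝ (Fin d)) → ℝ}
    (h : boueDupuis_formula P hW.natFiltration W T F) (hFm : Measurable F)
    (hFb : ∃ C, ∀ x, |F x| ≤ C) :
    -Real.log (∫ ω, Real.exp (-F (pathOn T W ω)) ∂P) = boueDupuisValue P hW.natFiltration W T F :=
  h hW.isFBrownianVec_natFiltration hFm hFb

/-- Under the Boué–Dupuis formula every admissible drift gives an **upper bound on the free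
energy**: `-log E e^{-F(W)} ≤ E[F(W + ∫₀^· v) + ½ ∫₀ᵀ ‖v‖²]` (the direction used for upper
bounds in Barashkov–Gubinelli's variational method). [cite: BarashkovGubinelli2020, Thm 2] -/
theorem boueDupuis_formula.neg_log_le_boueDupuisCost {P : Measure Ω} [IsProbabilityMeasure P]
    {ℱ : Filtration ℝ≥0 mΩ} {W : ℝ≥0 → Ω → EuclideanSpace ℝ (Fin d)} {T : ℝ≥0}
    {F : (Icc (0 : ℝ≥0) T → EuclideanSpace ℝ (Fin d)) → ℝ}
    (h : boueDupuis_formula P ℱ W T F) (hW : IsFBrownianVec ℱ (fun t ω ↦ WithLp.ofLp (W t ω)) P)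
    (hFm : Measurable F) (hFb : ∃ C, ∀ x, |F x| ≤ C) {v : ℝ≥0 → Ω → EuclideanSpace ℝ (Fin d)}
    (hv : IsAdmissibleDrift ℱ P T v) :
    -Real.log (∫ ω, Real.exp (-F (pathOn T W ω)) ∂P) ≤ boueDupuisCost P W T F v := by
  rw [h hW hFm hFb]
  obtain ⟨C, hC⟩ := hFb
  exact boueDupuisValue_le_boueDupuisCost ⟨-C, fun x ↦ (abs_le.1 (hC x)).1⟩ hv

end FBrownian

end Literature.Probability.Process
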